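import Mathlib
import HarnessLib
import Literature.Analysis.FluidPDE.KNSSThm52Assembly
import Literature.Analysis.FluidPDE.HouLiSpaceTime
import Literature.Analysis.FluidPDE.SpaceTimeCalculus
import Literature.Analysis.FluidPDE.AxisymRadialQuotient
import Summits.NavierStokesRegularity.NavierStokesRegularity.Theorems.UnthreadedDoorCapSymZonalToroidalStructure
import Summits.NavierStokesRegularity.NavierStokesRegularity.Theorems.RungBlowupCofinal.CasimirCutRotationInvariance

/-!
# Route `UnthreadedDoor`, crux `PoloidalLiouville` (stmt-NavierStokesRegularity-1222), WALL W1 `stub_scalarLiouville` —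
# crux idea «capsym-comparison» (ns-idea-13), line input FL-C `CapSym.ZonalToroidalLiouville`: STEP (4a), THE SCALAR FAMILY

Step (4) of the FL-C handoff plan (`FLC-HANDOFF.md`, evidence on 1222), first half: the space–time regularity of the scalar
`f(t) = B_φ/ϖ = hadamardQuotFst ((∇U(t) × ·) ·)₁` of the toroidal field `B(t) = ∇U(t) × x` of a zonal potential `U` jointly
smooth on `]−∞,0[ × ℝ³`, and the joint continuity of the gradient and the `ℝ⁵`-Laplacian of its `SO(4)`-lift — i.e. the
"solution class" clauses of `KNSS2009_lemma21_halfball` for the lifted family, obtained here from JOINT SMOOTHNESS (the tree's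
`KNSSThm52Assembly` obtained them from Lipschitz-in-time bounds of KNSS §4, which FL-C does not carry):

* `CapSym.gradient_rotZ`, `CapSym.isAxisymmetric_cross_gradient` — `∇U(R_θ x) = R_θ ∇U(x)` and `B = ∇U × x` is an
  axisymmetric vector field for an axisymmetric scalar `U` (`rotZ_cross` of `…RungBlowupCofinal.CasimirCutRotationInvariance`);
* `CapSym.isAxisymmetricScalar_hadamardQuotFst_cross_gradient` — `f = B_φ/ϖ` is an axisymmetric scalar;
* `CapSym.crossGradient_family`, `CapSym.hadamardQuotFst_crossGradient_family` — `B` and `f` are jointly smooth on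
  `]−∞,0[ × ℝ³` (`IsSmoothSpaceTimeOn.hadamardQuotFst_family`);
* `CapSym.deriv_cross_gradient_eq_deriv_smul_rotGen` — `∂ₜB(t,x) = ∂ₜf(t,x) · Jx`, hence `⟪∂ₜB, Jx⟫ = ϖ² ∂ₜf`;
* `CapSym.continuous_subtype_prod_of_continuousOn`, `CapSym.continuousOn_prod_of_continuous_subtype` — plumbing between
  `ContinuousOn (Iio 0 ×ˢ univ)` and continuity on `↥(Iio 0) × X`;
* `CapSym.liftAx_family_continuousOn_of_smooth` — for a jointly smooth family of axisymmetric scalars `f`,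
  `(t, y) ↦ D(liftAx (f t))(y)` and `(t, y) ↦ Δ₅(liftAx (f t))(y)` are continuous on `]−∞,0[ × ℝ⁵`
  (`continuous_liftDeriv_param`, `continuous_laplacian_liftAx_param` with parameter space `↥(Iio 0)`);
* `CapSym.norm_iteratedFDeriv_apply_one_le`, `CapSym.hadamardQuotFst_apply_one_bounds` — sup bounds of
  `f = hadamardQuotFst (B ·)₁`, `Df`, `D∂ᵢf`, `hadamardQuotFst ∂₀f` from the `iteratedFDeriv` bounds of `B` of orders `1, 2, 3`
  (`hadamardQuotFst_liftData_bounds`);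
* `CapSym.inner_smul_rotGen_rotGen` — `⟪c Jx, Jx⟫ = ϖ² c`.

WHAT THIS IS NOT: no NS-regularity statement is touched; FL-C is NOT proved here (the assembly with
`KNSSMaxPrincipleR5.eq_zero_of_abs_mul_le` is the companion file `…CapSymZonalToroidalLiouville`); `PoloidalLiouville` (1222),
its wall and the summit stay OPEN.  `--supports stmt-NavierStokesRegularity-1222 --as helper`.
[cite: KochNadirashviliSereginSverak2009, §5 Remark 5.1 and proof of Thm 5.2 (Acta Math. 203, pp. 97–98)]
-/

noncomputable section

-- the summit and its single sub-problem share the name (CONVENTIONS §1)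
set_option linter.dupNamespace false

open Set Function Filter Topology InnerProductSpace
open scoped RealInnerProductSpace Laplacian ContDiff

namespace Summit.NavierStokesRegularity.NavierStokesRegularity.Theorems.PoloidalLiouville.CapSym

open Literature.Analysis Literature.Analysis.FluidPDE

/-! ### Axisymmetry of `B = ∇U × x` and of `f = B_φ/ϖ` -/

/-- **The gradient of an axisymmetric scalar is an axisymmetric vector field**: `∇U(R_θ x) = R_θ ∇U(x)`. [folklore] -/
theorem gradient_rotZ {U : EuclideanSpace ℝ (Fin 3) → ℝ} (hax : IsAxisymmetricScalar U)
    (hd : Differentiable ℝ U) (θ : ℝ) (x : EuclideanSpace ℝ (Fin 3)) :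
    gradient U (rotZ θ x) = rotZ θ (gradient U x) := by
  refine ext_inner_right ℝ fun v => ?_
  have hv : v = rotZ θ (rotZ (-θ) v) := by rw [← rotZ_add, add_neg_cancel, rotZ_zero]
  rw [LocalHelmholtz.inner_gradient_left_eq_fderiv]
  conv_lhs => rw [hv]
  rw [hax.fderiv_rotZ_apply_rotZ hd θ x, ← LocalHelmholtz.inner_gradient_left_eq_fderiv]
  conv_rhs => rw [hv]
  rw [← rotZLIE_apply θ (gradient U x), ← rotZLIE_apply θ (rotZ (-θ) v), LinearIsometryEquiv.inner_map_map]

/-- **`B = ∇U × x` is axisymmetric** for an axisymmetric differentiable scalar `U`. [folklore] -/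
theorem isAxisymmetric_cross_gradient {U : EuclideanSpace ℝ (Fin 3) → ℝ} (hax : IsAxisymmetricScalar U)
    (hd : Differentiable ℝ U) :
    IsAxisymmetric (fun y : EuclideanSpace ℝ (Fin 3) => cross (gradient U y) y) := by
  intro θ x
  simp only
  rw [gradient_rotZ hax hd, _root_.Summit.NavierStokesRegularity.AngularGalerkinLadderCasimirRotation.rotZ_cross]

/-- **`f = B_φ/ϖ = hadamardQuotFst (B ·)₁` is an axisymmetric scalar** for `U ∈ C²` axisymmetric: `B = f · J`
(`cross_gradient_eq_hadamardQuotFst_smul_rotGen`), `B(R_θx) = R_θ B(x)`, `J(R_θ x) = R_θ Jx ≠ 0` off the axis (the pattern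
of `isAxisymmetricScalar_of_curl_structure`). [cite: KochNadirashviliSereginSverak2009, §5 Remark 5.1] -/
theorem isAxisymmetricScalar_hadamardQuotFst_cross_gradient {U : EuclideanSpace ℝ (Fin 3) → ℝ}
    (hU : ContDiff ℝ 2 U) (hax : IsAxisymmetricScalar U) :
    IsAxisymmetricScalar (hadamardQuotFst fun y : EuclideanSpace ℝ (Fin 3) => cross (gradient U y) y 1) := by
  intro θ x
  set f := hadamardQuotFst (fun y : EuclideanSpace ℝ (Fin 3) => cross (gradient U y) y 1) with hf
  have hd : Differentiable ℝ U := hU.differentiable (by norm_num)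
  have h := isAxisymmetric_cross_gradient hax hd θ x
  simp only at h
  rw [cross_gradient_eq_hadamardQuotFst_smul_rotGen hU hax (rotZ θ x),
    cross_gradient_eq_hadamardQuotFst_smul_rotGen hU hax x, rotGen_rotZ] at h
  have hlin : rotZ θ (f x • rotGen x) = f x • rotZ θ (rotGen x) := by
    ext i; fin_cases i <;> simp <;> ring
  rw [hlin] at h
  have hsub : (f (rotZ θ x) - f x) • rotZ θ (rotGen x) = 0 := by rw [sub_smul, h, sub_self]
  by_cases hax' : x 0 = 0 ∧ x 1 = 0
  · rw [rotZ_eq_self_of_axis θ hax'.1 hax'.2]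
  · have hne : rotZ θ (rotGen x) ≠ 0 := by
      intro hz
      have hn : ‖rotZ θ (rotGen x)‖ = 0 := by rw [hz, norm_zero]
      rw [norm_rotZ, norm_eq_zero] at hn
      have h0' := congrFun (congrArg (⇑) hn) 0
      have h1' := congrFun (congrArg (⇑) hn) 1
      simp only [rotGen_apply_zero, rotGen_apply_one, PiLp.zero_apply, neg_eq_zero] at h0' h1'
      exact hax' ⟨h1', h0'⟩
    have := (smul_eq_zero.1 hsub).resolve_right hne
    linarith

/-! ### Joint smoothness of `B` and `f` on `]−∞,0[ × ℝ³`; the time derivative -/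

variable {U : ℝ → EuclideanSpace ℝ (Fin 3) → ℝ}

/-- **`B(t,y) = ∇U(t,y) × y` is jointly smooth** on `]−∞,0[ × ℝ³` for `U` jointly smooth there. [folklore] -/
theorem crossGradient_family (hU : IsSmoothSpaceTimeOn (Iio 0) U) :
    IsSmoothSpaceTimeOn (Iio 0) fun t y => cross (gradient (U t) y) y := by
  have hS : UniqueDiffOn ℝ (Iio (0 : ℝ)) := uniqueDiffOn_Iio 0
  have hL : IsSmoothSpaceTimeOn (Iio 0) fun t y => crossCLM (gradient (U t) y) := (hU.gradient hS).clm crossCLM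
  have hid : IsSmoothSpaceTimeOn (Iio 0) fun (_ : ℝ) (y : EuclideanSpace ℝ (Fin 3)) => y :=
    isSmoothSpaceTimeOn_const_time contDiff_id _
  exact hL.clm_apply hid

/-- **`f(t) = hadamardQuotFst (B(t) ·)₁` is jointly smooth** on `]−∞,0[ × ℝ³`
(`IsSmoothSpaceTimeOn.hadamardQuotFst_family`). [cite: KochNadirashviliSereginSverak2009, §5 Remark 5.1] -/
theorem hadamardQuotFst_crossGradient_family (hU : IsSmoothSpaceTimeOn (Iio 0) U) :
    IsSmoothSpaceTimeOn (Iio 0) fun t =>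
      hadamardQuotFst fun y : EuclideanSpace ℝ (Fin 3) => cross (gradient (U t) y) y 1 :=
  ((crossGradient_family hU).euclidean_comp 1).hadamardQuotFst_family (convex_Iio 0) (uniqueDiffOn_Iio 0)

/-- **`∂ₜB = ∂ₜf · J`**: for `U` jointly smooth on `]−∞,0[ × ℝ³` with axisymmetric slices and `t < 0`,
`deriv (B · x) t = deriv (f · x) t • Jx`, where `B(s) = ∇U(s) × ·`, `f(s) = hadamardQuotFst (B(s) ·)₁`
(`B(s,x) = f(s,x) Jx` for all `s < 0`, an open set of times). [folklore] -/
theorem deriv_cross_gradient_eq_deriv_smul_rotGen (hU : IsSmoothSpaceTimeOn (Iio 0) U)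
    (hax : ∀ t < 0, IsAxisymmetricScalar (U t)) {t : ℝ} (ht : t < 0) (x : EuclideanSpace ℝ (Fin 3)) :
    HasDerivAt (fun s => hadamardQuotFst (fun y : EuclideanSpace ℝ (Fin 3) => cross (gradient (U s) y) y 1) x)
      (deriv (fun s => hadamardQuotFst (fun y : EuclideanSpace ℝ (Fin 3) => cross (gradient (U s) y) y 1) x) t) t ∧
    deriv (fun s => cross (gradient (U s) x) x) t =
      deriv (fun s => hadamardQuotFst (fun y : EuclideanSpace ℝ (Fin 3) => cross (gradient (U s) y) y 1) x) t •
        rotGen x := by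
  have hf := (hadamardQuotFst_crossGradient_family hU).hasDerivAt_timeLine isOpen_Iio ht x
  refine ⟨hf, ?_⟩
  have hev : (fun s => cross (gradient (U s) x) x) =ᶠ[𝓝 t]
      fun s => hadamardQuotFst (fun y : EuclideanSpace ℝ (Fin 3) => cross (gradient (U s) y) y 1) x • rotGen x := by
    filter_upwards [Iio_mem_nhds ht] with s hs
    have hU2 : ContDiff ℝ 2 (U s) := (hU.contDiff_slice hs).of_le (by norm_cast)
    exact cross_gradient_eq_hadamardQuotFst_smul_rotGen hU2 (hax s hs) x
  exact ((hf.smul_const (rotGen x)).congr_of_eventuallyEq hev).deriv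

/-- `⟪c • Jx, Jx⟫ = ϖ² c`, `ϖ² = x₀² + x₁²`. [folklore] -/
theorem inner_smul_rotGen_rotGen (c : ℝ) (x : EuclideanSpace ℝ (Fin 3)) :
    ⟪c • rotGen x, rotGen x⟫ = (x 0 ^ 2 + x 1 ^ 2) * c := by
  rw [real_inner_smul_left, inner_rotGen_self_eq, mul_comm]

/-! ### From `ContinuousOn (Iio 0 ×ˢ univ)` to continuity on `↥(Iio 0) × X` and back -/

section SubtypeParam

variable {Y Z : Type*} [TopologicalSpace Y] [TopologicalSpace Z] {S : Set ℝ}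

/-- A function continuous on `S × Y` is continuous on the subtype product `↥S × Y`. [folklore] -/
theorem continuous_subtype_prod_of_continuousOn {g : ℝ × Y → Z} (h : ContinuousOn g (S ×ˢ univ)) :
    Continuous fun q : S × Y => g ((q.1 : ℝ), q.2) :=
  h.comp_continuous ((continuous_subtype_val.comp continuous_fst).prodMk continuous_snd)
    fun q => ⟨q.1.2, mem_univ _⟩

/-- A function continuous on the subtype product `↥S × Y` is continuous on `S × Y`. [folklore] -/
theorem continuousOn_prod_of_continuous_subtype {g : ℝ × Y → Z}
    (h : Continuous fun q : S × Y => g ((q.1 : ℝ), q.2)) : ContinuousOn g (S ×ˢ univ) := by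
  rw [continuousOn_iff_continuous_restrict]
  have e : (S ×ˢ (univ : Set Y)).restrict g =
      (fun q : S × Y => g ((q.1 : ℝ), q.2)) ∘
        fun p : ↥(S ×ˢ (univ : Set Y)) => ((⟨p.1.1, p.2.1⟩ : S), p.1.2) := by
    funext p; rfl
  rw [e]
  exact h.comp ((continuous_subtype_val.fst.subtype_mk fun p => p.2.1).prodMk continuous_subtype_val.snd)

end SubtypeParam

/-! ### The lifted family: joint continuity of `D f̃` and `Δ₅ f̃` from joint smoothness -/

/-- **Joint continuity of `D f̃` and `Δ₅ f̃` on `]−∞,0[ × ℝ⁵`** for the lift `f̃(t) = liftAx (f t)` of a family of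
axisymmetric scalars `f` JOINTLY SMOOTH on `]−∞,0[ × ℝ³`: the lift data `∂₂ f`, `∂ᵢ∂ᵢ f`, `hadamardQuotFst ∂₀ f` are
slices of jointly smooth families (`IsSmoothSpaceTimeOn.fderiv_slice_apply`), so `continuous_liftDeriv_param` /
`continuous_laplacian_liftAx_param` apply with parameter space `↥(Iio 0)` (the tree's `liftAx_family_continuousOn` is the
Lipschitz-in-time variant). [folklore] -/
theorem liftAx_family_continuousOn_of_smooth {f : ℝ → EuclideanSpace ℝ (Fin 3) → ℝ}
    (hf : IsSmoothSpaceTimeOn (Iio 0) f) (hfax : ∀ t < 0, IsAxisymmetricScalar (f t)) :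
    ContinuousOn (fun p : ℝ × EuclideanSpace ℝ (Fin 5) => fderiv ℝ (liftAx (f p.1)) p.2) (Iio 0 ×ˢ univ) ∧
    ContinuousOn (fun p : ℝ × EuclideanSpace ℝ (Fin 5) => (Δ (liftAx (f p.1))) p.2) (Iio 0 ×ˢ univ) := by
  have hS : UniqueDiffOn ℝ (Iio (0 : ℝ)) := uniqueDiffOn_Iio 0
  have hsm : ∀ t < 0, ContDiff ℝ ∞ (f t) := fun t ht => hf.contDiff_slice ht
  have hev : ∀ t < 0, IsEvenC 0 (f t) := fun t ht => (hfax t ht).isEvenC_zero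
  have h0 : ∀ t < 0, ∀ x : EuclideanSpace ℝ (Fin 3), x 0 = 0 →
      fderiv ℝ (f t) x (EuclideanSpace.single 0 1) = 0 := fun t ht x hx =>
    (hev t ht).fderiv_single_zero_eq_zero ((hsm t ht).differentiable (by simp)) hx
  have hD1 : ∀ v, IsSmoothSpaceTimeOn (Iio 0) fun t x => fderiv ℝ (f t) x v := fun v =>
    hf.fderiv_slice_apply hS v
  have hD2 : ∀ v v', IsSmoothSpaceTimeOn (Iio 0) fun t x => fderiv ℝ (fun z => fderiv ℝ (f t) z v) x v' :=
    fun v v' => (hD1 v).fderiv_slice_apply hS v'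
  -- continuity on the subtype product `↥(Iio 0) × ℝ³`
  have h2 : Continuous fun q : ↥(Iio (0 : ℝ)) × EuclideanSpace ℝ (Fin 3) =>
      fderiv ℝ (f q.1) q.2 (EuclideanSpace.single 2 1) :=
    continuous_subtype_prod_of_continuousOn (hD1 _).continuousOn
  have hii : ∀ i : Fin 3, Continuous fun q : ↥(Iio (0 : ℝ)) × EuclideanSpace ℝ (Fin 3) =>
      fderiv ℝ (fun z => fderiv ℝ (f q.1) z (EuclideanSpace.single i 1)) q.2 (EuclideanSpace.single i 1) :=
    fun i => continuous_subtype_prod_of_continuousOn (hD2 _ _).continuousOn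
  have hLD : Continuous fun q : ↥(Iio (0 : ℝ)) × EuclideanSpace ℝ (Fin 5) => liftDeriv (f q.1) q.2 :=
    continuous_liftDeriv_param (w := fun p : ↥(Iio (0 : ℝ)) => f p.1) (hii 0) h2
  have hLΔ : Continuous fun q : ↥(Iio (0 : ℝ)) × EuclideanSpace ℝ (Fin 5) => (Δ (liftAx (f q.1))) q.2 :=
    continuous_laplacian_liftAx_param (w := fun p : ↥(Iio (0 : ℝ)) => f p.1)
      (fun p => (hsm p.1 p.2).of_le (by norm_cast)) (fun p => hev p.1 p.2) (hii 0) (hii 2)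
  constructor
  · refine (continuousOn_prod_of_continuous_subtype
      (g := fun p : ℝ × EuclideanSpace ℝ (Fin 5) => liftDeriv (f p.1) p.2) hLD).congr fun p hp => ?_
    exact fderiv_liftAx ((hsm p.1 hp.1).of_le (by norm_cast)) (h0 p.1 hp.1) p.2
  · exact continuousOn_prod_of_continuous_subtype
      (g := fun p : ℝ × EuclideanSpace ℝ (Fin 5) => (Δ (liftAx (f p.1))) p.2) hLΔ

/-! ### Sup bounds of the lift data of `f(t)` from the `iteratedFDeriv` bounds of `B(t)` -/

/-- The coordinate projection `v ↦ v₁` has operator norm `≤ 1`. [folklore] -/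
theorem norm_proj_one_le : ‖(EuclideanSpace.proj (1 : Fin 3) : EuclideanSpace ℝ (Fin 3) →L[ℝ] ℝ)‖ ≤ 1 :=
  ContinuousLinearMap.opNorm_le_bound _ zero_le_one fun v => by
    rw [one_mul]; simpa using PiLp.norm_apply_le v 1

/-- `‖Dⁿ(B ·)₁‖ ≤ ‖Dⁿ B‖` pointwise for a smooth field `B`. [folklore] -/
theorem norm_iteratedFDeriv_apply_one_le {B : EuclideanSpace ℝ (Fin 3) → EuclideanSpace ℝ (Fin 3)}
    (hB : ContDiff ℝ ∞ B) (n : ℕ) (x : EuclideanSpace ℝ (Fin 3)) :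
    ‖iteratedFDeriv ℝ n (fun y => B y 1) x‖ ≤ ‖iteratedFDeriv ℝ n B x‖ := by
  have h := (EuclideanSpace.proj (1 : Fin 3) : EuclideanSpace ℝ (Fin 3) →L[ℝ] ℝ).norm_iteratedFDeriv_comp_left
    (hB.contDiffAt (x := x)) (n := n) (by exact_mod_cast le_top)
  have e : ((EuclideanSpace.proj (1 : Fin 3) : EuclideanSpace ℝ (Fin 3) →L[ℝ] ℝ) ∘ B) = fun y => B y 1 := rfl
  rw [e] at h
  calc _ ≤ ‖(EuclideanSpace.proj (1 : Fin 3) : EuclideanSpace ℝ (Fin 3) →L[ℝ] ℝ)‖ * ‖iteratedFDeriv ℝ n B x‖ := h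
    _ ≤ 1 * ‖iteratedFDeriv ℝ n B x‖ := mul_le_mul_of_nonneg_right norm_proj_one_le (norm_nonneg _)
    _ = _ := one_mul _

/-- **Sup bounds of `f = hadamardQuotFst (B ·)₁` and its lift data** from sup bounds `C₁, C₂, C₃` of `DB, D²B, D³B`
(`B` smooth): `|f| ≤ C₁`, `‖Df‖ ≤ C₂`, `‖D(∂ᵢf)‖ ≤ C₃`, `|hadamardQuotFst ∂₀f| ≤ C₃`
(KNSS Remark 5.1: `ω_θ/r` is bounded with its derivatives). [cite: KochNadirashviliSereginSverak2009, §5 Remark 5.1] -/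
theorem hadamardQuotFst_apply_one_bounds {B : EuclideanSpace ℝ (Fin 3) → EuclideanSpace ℝ (Fin 3)}
    (hB : ContDiff ℝ ∞ B) {C₁ C₂ C₃ : ℝ} (h1 : ∀ y, ‖iteratedFDeriv ℝ 1 B y‖ ≤ C₁)
    (h2 : ∀ y, ‖iteratedFDeriv ℝ 2 B y‖ ≤ C₂) (h3 : ∀ y, ‖iteratedFDeriv ℝ 3 B y‖ ≤ C₃)
    (x : EuclideanSpace ℝ (Fin 3)) :
    |hadamardQuotFst (fun y => B y 1) x| ≤ C₁ ∧
    ‖fderiv ℝ (hadamardQuotFst fun y => B y 1) x‖ ≤ C₂ ∧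
    (∀ i : Fin 3, ‖fderiv ℝ (fun z => fderiv ℝ (hadamardQuotFst fun y => B y 1) z
      (EuclideanSpace.single i 1)) x‖ ≤ C₃) ∧
    |hadamardQuotFst (fun z => fderiv ℝ (hadamardQuotFst fun y => B y 1) z (EuclideanSpace.single 0 1)) x| ≤ C₃ := by
  have hw : ContDiff ℝ ∞ (fun y => B y 1) :=
    (contDiff_piLp_apply (𝕜 := ℝ) (p := 2) (n := ∞) (i := (1 : Fin 3))).comp hB
  have hw1 : ∀ y, ‖fderiv ℝ (fun y => B y 1) y‖ ≤ C₁ := fun y => by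
    rw [norm_fderiv_eq_norm_iteratedFDeriv_one]
    exact (norm_iteratedFDeriv_apply_one_le hB 1 y).trans (h1 y)
  have hw2 : ∀ y, ‖iteratedFDeriv ℝ 2 (fun y => B y 1) y‖ ≤ C₂ := fun y =>
    (norm_iteratedFDeriv_apply_one_le hB 2 y).trans (h2 y)
  have hw3 : ∀ y, ‖iteratedFDeriv ℝ 3 (fun y => B y 1) y‖ ≤ C₃ := fun y =>
    (norm_iteratedFDeriv_apply_one_le hB 3 y).trans (h3 y)
  obtain ⟨hD, hdir, hq⟩ := hadamardQuotFst_liftData_bounds hw hw2 hw3 x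
  refine ⟨?_, hD, hdir, hq⟩
  have h := norm_hadamardQuotFst_le hw1 x
  rwa [Real.norm_eq_abs] at h

end Summit.NavierStokesRegularity.NavierStokesRegularity.Theorems.PoloidalLiouville.CapSym

end
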